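import Literature.NumberTheory.DiophantineGeometry.BcgpSwitchExistsModularAbelianSurface
import HarnessLib

/-!
# Boxer–Calegari–Gee–Pilloni 2025, Theorem A: abelian surfaces over `ℚ` with surjective
# mod-`3` Galois representation (good ordinary and `3`-distinguished at `3`, a condition at `2`)
# are modular

Topic `Literature/NumberTheory/DiophantineGeometry` (next to `BcgpResiduallyA5bModular`,
`BcgpSwitchingSurface`, `BcgpSwitchExistsModularAbelianSurface`, which record the two halves of
its printed proof). ONE named fact (D-0014), no proof, no new definition: the MAIN THEOREM of
G. Boxer, F. Calegari, T. Gee, V. Pilloni, *Modularity theorems for abelian surfaces*,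
arXiv:2502.20645 (2025) — Theorem A (the first Theorem of §1.1; the two introduction theorems are
LETTERED A, B — `\newtheorem{ithm}` — while all other numbered items share one counter per
subsection; TeX label `first`; chunk p0003 L7–28 of the held arXiv TeX rendering
`paper:arxiv-2502.20645`, a chunk id, not a PDF page; numbering verified against the arXiv v1
source counters / HTML render by the cell's second literature seat, `lit/LIT2-RESIDUAL-MODULARITY.md`
§8; restated verbatim in T. Gee's ICM survey [Gee2026], §1), in the tree's vocabulary and with EXACTLY the conclusion
clause (almost-everywhere `GL₄` form) of the accepted sibling facts
`Literature.NumberTheory.DiophantineGeometry.bcgp_residuallyA5b_modular_abelianSurface` and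
`Literature.NumberTheory.DiophantineGeometry.bcgp_switch_exists_modular_abelianSurface`.
Vendored by the literature seat of the venture cell `pub-residmod` (residual-modularity census of
genus-2 Jacobians: a certified mod-`3` image + the local conditions below ⇒ modular, by THIS
theorem; `run/shared/lean/pub/pub-residmod/lit/BCGP-AS-PRINTED.md`, §B2).

## The printed statement

Theorem A, verbatim: "Let `A/ℚ` be an abelian surface with a polarization of degree prime to
`3`. Suppose the following holds: (1) The mod `3` representation
`ρ̄_{A,3} : Gal(ℚ̄/ℚ) → GSp₄(𝔽₃)` is surjective. (2) `ρ̄_{A,3}|_{G_{ℚ₂}}` is unramified, and the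
characteristic polynomial of `ρ̄_{A,3}(Frob₂)` is not `(x² ± x + 2)²`. (3) `A` has good ordinary
reduction at `3` and the characteristic polynomial of Frobenius at `3` does not have repeated
roots. Then `A` is modular. More precisely, there exists a cuspidal automorphic representation `π`
for `GL₄/ℚ` (the transfer of a cuspidal automorphic representation of `GSp₄/ℚ` of weight `2`)
such that `L(s, H¹(A)) = L(s, π)`, and hence `L(s, H¹(A))` has a holomorphic continuation to `ℂ`
satisfying the expected functional equation."

Conventions of the source (§1.8.23, chunk p0011 L42–79): `ρ_{A,p}` is the representation on
`H¹(A_ℚ̄, ℤ_p)` (multiplier `ε⁻¹`), `ρ̄_{A,p}` the one on `H¹(A_ℚ̄, 𝔽_p)`; "If `A` admits a principal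
polarization of degree prime to `p`, then we can and do think of `ρ̄_{A,p}` as a representation
`ρ̄_{A,p} : G_F → GSp₄(𝔽̄_p)`"; "the Galois representations associated to `T_p(A)` and `A[p]` are
the dual representations `ρ^∨_{A,p} ≃ ρ_{A,p} ⊗ ε` and `ρ̄^∨_{A,p} ≃ ρ̄_{A,p} ⊗ ε`". Modularity
(§1.8.24, Definition 1.8.25): "An abelian surface `A/F` is modular … if there exist `C`-algebraic
cuspidal automorphic representations `π_i` for `GL_{n_i}/F` with `4 = Σ n_i` such that
`L(s, H¹(A)) = ∏ L(s, π_i ⊗ |det|^{(1-n_i)/2})`."  How it is proved (§9.5, chunks p0136–p0137 of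
the TeX rendering): Theorem A is the case `im ρ̄_{A,3} = GSp₄(𝔽₃)` of Theorem 9.5.2 (label
`firstlater`: image among the 15 subgroups of Lemma 6.4.3 / Table 6.4.4 and `End(A_ℚ̄) = ℤ`; "if `ρ̄_{A,3}` is surjective, then `End(A_ℚ̄) = ℤ` is automatic"), whose proof is
the `2`–`3` switch: Lemma 9.4.2 (2) (tree: `bcgp_switchingSurface_exists`) + the `2`-adic
Theorem 8.3.2 (tree: `bcgp_residuallyA5b_modular_abelianSurface`) make `ρ̄_{A,3}` residually
modular — the first half, FORMALISED in `BcgpSwitchExistsModularAbelianSurfaceProofs.lean` — and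
then the `p > 2` congruence-lifting Theorem 9.5.1 at `p = 3`.

## Rendering (clause by clause; the reading reviewers should attack)

HYPOTHESES on `A : AbelianVariety ℚ` with `A.dim = 2`, a torsion frame `(ρ₀, e)` of `A[3](ℚ̄)`
(`e : A.geomTorsion 3 ≃+ (ℤ/3)⁴`, `e (σ • P) = ρ₀(σ) · e(P)` — such frames exist,
`AbelianVariety.exists_framedGaloisRep_geomTorsion_surface`) and `ρb = ρ₀^∨`
(`FramedRep.dual ρ₀`, `ρb(σ) = ρ₀(σ)⁻ᵀ`: the representation on `A[3]^∨ = H¹(A_ℚ̄, 𝔽₃)`, i.e. the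
paper's `ρ̄_{A,3}`):
* (0)+(1) "a polarization of degree prime to `3`" and "`ρ̄_{A,3} : Gal(ℚ̄/ℚ) → GSp₄(𝔽₃)` is
  surjective" are rendered TOGETHER, by what the source uses the polarization for (§1.8.23 quoted
  above: it makes `ρ̄_{A,3}` a `GSp₄`-valued representation, of multiplier `ε̄⁻¹`) plus
  surjectivity onto that `GSp₄` (§1.8.23 quoted above): there is an invertible alternating `J ∈ M₄(𝔽₃)` with
  `ρb(σ)ᵀ J ρb(σ) = ε̄(σ)⁻¹ J` for all `σ` (`ε̄ = modPCyclotomicCharacterZMod ℚ 3`; this conjunct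
  is literally `ρb.IsSymplecticWithMultiplierFun (ε̄⁻¹)` unfolded, the first hypothesis of
  `bcgp_switch_exists_modular_abelianSurface`) AND every similitude of `J` (every `M` with
  `Mᵀ J M = c J`, `c ∈ 𝔽₃ˣ`) is some `ρb(σ)` — i.e. `ρb(Γ_ℚ) = GSp(J)(𝔽₃) ≅ GSp₄(𝔽₃)`.  (The
  tree's `AbelianVariety` has no polarisations or dual abelian variety, so "degree prime to `3`"
  cannot be spelled as such; for a prime-to-`3` polarisation `λ` the Weil pairing `e₃^λ` on
  `A[3]` is such a `J` — [Milne1986AbelianVarieties, §16], the tree's named fact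
  `weilPairing_rationalTateModule` and `AVSymplecticOfWeilPairing.lean`, which even derives the
  symplectic clause for IRREDUCIBLE `ρb` without any polarisation hypothesis.  So the typed
  hypothesis is implied by the printed one and carries everything the printed proof uses of it.)
* (2) verbatim the third hypothesis of `bcgp_switch_exists_modular_abelianSurface`: at the place
  `v ∣ 2`, `ρb` is unramified and every Frobenius characteristic polynomial `Q` of `ρb` at `v`
  (`FramedGaloisRep.HasFrobCharpolyAt`, arithmetic Frobenius) differs from `(X² + X + 2)²` and from
  `(X² − X + 2)²` (the set `{(X² ± X + 2)²}` is stable under `X ↦ 2X⁻¹`-reciprocity and duality, so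
  the arithmetic/geometric and `A[3]`/`A[3]^∨` conventions do not matter; §10.1 prints the same
  condition as "`x⁴ ± x³ + 2x² ± x + 1`", which are these two squares mod `3`).
* (3a) "`A` has good ordinary reduction at `3`": the tree's `AbelianVariety.HasGoodOrdinaryReductionAt`
  (an abelian-scheme model over `ℤ_(3)` whose special fibre has `3^{dim}` geometric `3`-torsion
  points), at the place above `3`, as in `bcgp_switchingSurface_exists`.
* (3b) "the characteristic polynomial of Frobenius at `3` does not have repeated roots": for every
  prime `ℓ ≠ 3`, every `ℚ_ℓ`-basis `b` of `V_ℓ(A)` and the framed dual `r` of `V_ℓ(A)` in the dual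
  basis (`r(g) = [g⁻¹]_bᵀ`, the paper's `ρ_{A,ℓ}` on `H¹`; frame clause verbatim from the sibling
  facts), `r` is unramified at `v ∣ 3` and every Frobenius characteristic polynomial `Q ∈ ℚ̄_ℓ[X]`
  of `r` at `v` is separable (`Polynomial.Separable`; over a field of characteristic `0` this is
  "no repeated roots in an algebraic closure", Mathlib `Polynomial.nodup_roots_iff_of_splits`).
  Asking it for ALL `ℓ ≠ 3` (in print: THE characteristic polynomial of Frobenius at the good
  prime `3`, an integer polynomial independent of `ℓ`) only strengthens the hypothesis.  Under
  (3a) this is the source's "`A` is `3`-distinguished" (Definition 1.8.10 in §1.8.9; Theorem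
  9.5.2 (3)) — the unit roots `α ≠ β`; Definition 9.1.2, verbatim: "if `B` has good ordinary
  reduction, then `B` is `p`-distinguished if and only if the characteristic polynomial `Q(x)` of
  `Frob_p` on `T_ℓ B`, `ℓ ≠ p`, has pairwise distinct roots, or equivalently if `Q(x)` is not a
  square" — exactly the separability asked here (dualising `T_ℓ B` does not change it).
CONCLUSION, verbatim the conclusion clause of `bcgp_residuallyA5b_modular_abelianSurface`: for
every prime `p`, every framed dual `r` of `V_p(A)` and every `ι : ℚ̄_p ≃ ℂ` (given the compactness
input `isCompact_glFiniteIntegralLevel 4 ℚ` that the tree's `CuspidalAutomorphicRepData` takes)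
there is an L-algebraic cuspidal automorphic representation `π` of `GL₄(𝔸_ℚ)` whose Satake
parameters `a_v` satisfy, for all but finitely many `v`, `r` unramified at `v` and
`det(X − r(Frob_v)) = arithFrobPolyOfSatake ι q_v 1 a_v` — the cofinite shadow of
`L(s, H¹(A)) = L(s, π)` (the `C`-algebraic `π` of print twisted to L-algebraic, as in the siblings).

What is deliberately NOT here: the `GSp₄` automorphic representation and its weight (the tree has
no `GSp₄` automorphic vocabulary — the same restriction as the siblings); the equality of
`L`-factors at the finitely many remaining places and the functional equation; the weakening of (1)
to the 15 subgroups of Lemma 6.4.3 / Table 6.4.4 (LMFDB labels 3.1620.1, 3.1620.5, 3.1620.10,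
3.1296.1, 3.810.2, 3.810.6, 3.540.1, 3.405.1, 3.270.1, 3.216.1, 3.135.1, 3.135.2, 3.45.1, 3.27.1, 1.1.1,
read off the e-print source by the cell's second literature seat; "GSp₄-reasonable in the sense of
[Whitmore]" is not yet in the tree); the curve forms (Theorem B of §1.1, Theorems 9.5.3/9.5.4: the
tree has no Jacobians) and the bad-reduction-at-`2` variant (Theorem 9.5.5, vendored separately as
`bcgp2025_modThreeSurjective_badAtTwo_modular_abelianSurface`).

## Status

CONDITIONAL IN PRINT (§1.6, chunk p0006 L39–54, verbatim): "this paper, as with the paper [BCGP],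
relies on results stated by Arthur in [Art04] which ultimately rely on references [A24], [A25],
[A26], and [A27] which have not (still) yet appeared, as well as cases of the twisted weighted
fundamental lemma announced in [CL10]. … As a result of the recent preprint [AGIKMS] … a complete
proof of all the missing ingredients from Arthur's papers is now available, and thus the only
result we use for which a proof is not yet available is the twisted weighted fundamental lemma."
The computations behind (2) (Lemma 9.1.3, §9.2) and behind §6.4 are Magma computations (Remark 9.1.5: "The computations in this section and the next are all done using [Magma], and the explicit
code with documentation can be found at [the authors' repository]").  The named fact is consumed,
as every named fact, as an explicit hypothesis `(h : bcgp2025_modThreeSurjective_modular_abelianSurface)`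
and carries exactly this status.  A discharge would have to formalise §§2–9 of the source (higher
Coleman/Hida theory, `p`-adic Eichler–Shimura theory and the classicality theorem, `2`-adic and
`3`-adic patching for `GSp₄`/`U(4)`, the `2`–`3` switch) and Arthur's transfer: SIZE XL, a theory
absent from Mathlib and the tree.

## References

* [BoxerCalegariGeePilloni2025] G. Boxer, F. Calegari, T. Gee, V. Pilloni, *Modularity theorems
  for abelian surfaces*, arXiv:2502.20645 (2025): §1.1 Theorem A (label `first`), §1.6, §1.8.9
  Definition 1.8.10 (ordinary, `p`-distinguished), §1.8.23, §1.8.24 Definition 1.8.25 (modular),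
  Definition 9.1.2, Lemma 6.4.3 / Table 6.4.4, Theorems 9.5.1, 9.5.2 and the proof of 9.5.2, §10.1.
* [Gee2026] T. Gee, *Modularity theorems for abelian surfaces*, ICM 2026, Vol. 3, 377–395
  (arXiv:2510.02756): §1, the restatement of the main theorem.
* [BoxerEtAl2021] G. Boxer, F. Calegari, T. Gee, V. Pilloni, *Abelian surfaces over totally real
  fields are potentially modular*, Publ. Math. IHÉS 134 (2021) 153–501: §2.1 (`GSp₄`, similitude),
  p. 158 (Thm 1.1.7 and the remark that a surjective mod-`3` image was out of reach in 2021).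
* [Milne1986AbelianVarieties] J. S. Milne, *Abelian varieties* (1986), §16 (Weil pairing of a
  polarisation).
-/

namespace Literature.NumberTheory.DiophantineGeometry

open CategoryTheory IsDedekindDomain
open scoped NumberField Matrix
open Literature.NumberTheory.GaloisRepresentations Literature.NumberTheory.Automorphic
open Literature.AlgebraicGeometry.Motives (AbelianVariety)

/-- **Boxer–Calegari–Gee–Pilloni 2025, Theorem A** (first Theorem of §1.1, arXiv:2502.20645;
`GL₄` almost-everywhere form). Every abelian surface `A/ℚ` (`AbelianVariety ℚ`, `dim A = 2`) such
that, for a torsion frame `(ρ₀, e)` of `A[3](ℚ̄)` and `ρb = ρ₀^∨` (the representation on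
`H¹(A_ℚ̄, 𝔽₃)`, the paper's `ρ̄_{A,3}`): (0)+(1) `ρb` is symplectic for an invertible alternating
`J` with multiplier `ε̄⁻¹` and its image is ALL of `GSp(J)(𝔽₃) ≅ GSp₄(𝔽₃)` ("`A` with a
polarization of degree prime to `3`", as used in §1.8.23, and "`ρ̄_{A,3}` is surjective");
(2) `ρb` is unramified at `2` with Frobenius characteristic polynomial `≠ (X² ± X + 2)²`;
(3) `A` has good ordinary reduction at `3` and, for every `ℓ ≠ 3`, the framed dual `r` of `V_ℓ(A)`
is unramified at `3` with separable Frobenius characteristic polynomial there ("the characteristic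
polynomial of Frobenius at `3` does not have repeated roots"; Definition 9.1.2) — is MODULAR: for every prime `p`,
every framed dual `r` of `V_p(A)` and every `ι : ℚ̄_p ≃ ℂ` there is an L-algebraic cuspidal
automorphic representation of `GL₄(𝔸_ℚ)` whose Satake parameters give `det(X − r(Frob_v))` at
all but finitely many `v` (VERBATIM the conclusion clause of
`bcgp_residuallyA5b_modular_abelianSurface`).  Conditional in print on the twisted weighted
fundamental lemma (§1.6; module docstring).  Users take
`(h : bcgp2025_modThreeSurjective_modular_abelianSurface)`.  Named fact (D-0014), not proved in
the tree.
[cite: BoxerCalegariGeePilloni2025, §1.1 Theorem A (label `first`); §1.8.23; §1.8.24 Definition 1.8.25 (modular; §1.8.22 transfer to GL₄); Definition 9.1.2; Theorem 9.5.2 and its proof; §1.6 (conditionality)]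
[cite: Gee2026, §1 (restatement of the main theorem)] -/
def bcgp2025_modThreeSurjective_modular_abelianSurface : Prop :=
  ∀ (A : AbelianVariety ℚ), A.dim = 2 →
    ∀ (ρ₀ : FramedGaloisRep ℚ (ZMod 3) 4) (e : A.geomTorsion (3 : ℕ) ≃+ (Fin 4 → ZMod 3))
      (ρb : FramedGaloisRep ℚ (ZMod 3) 4),
      (∀ (σ : Field.absoluteGaloisGroup ℚ) (P : A.geomTorsion (3 : ℕ)),
        e (σ • P) = ((ρ₀ σ : GL (Fin 4) (ZMod 3)) : Matrix (Fin 4) (Fin 4) (ZMod 3)) *ᵥ e P) →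
      FramedRep.dual ρ₀ = ρb →
    -- (0)+(1): `ρ̄_{A,3}` is `GSp₄`-valued with multiplier `ε̄⁻¹` and SURJECTIVE onto `GSp₄(𝔽₃)`
    (∃ J : Matrix (Fin 4) (Fin 4) (ZMod 3), Jᵀ = -J ∧ IsUnit J.det ∧
      (∀ σ : Field.absoluteGaloisGroup ℚ,
        (ρb σ).valᵀ * J * (ρb σ).val =
          (((modPCyclotomicCharacterZMod ℚ 3 σ)⁻¹ : (ZMod 3)ˣ) : ZMod 3) • J) ∧
      ∀ M : Matrix (Fin 4) (Fin 4) (ZMod 3),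
        (∃ c : (ZMod 3)ˣ, Mᵀ * J * M = (c : ZMod 3) • J) →
          ∃ σ : Field.absoluteGaloisGroup ℚ, (ρb σ).val = M) →
    -- (2): unramified at `2`, `charpoly ρ̄_{A,3}(Frob₂) ≠ (X² ± X + 2)²`
    (∀ v : HeightOneSpectrum (𝓞 ℚ), ((2 : ℕ) : 𝓞 ℚ) ∈ v.asIdeal →
      ρb.IsUnramifiedAt v ∧
        ∀ Q : Polynomial (ZMod 3), ρb.HasFrobCharpolyAt v Q →
          Q ≠ (Polynomial.X ^ 2 + Polynomial.X + 2) ^ 2 ∧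
            Q ≠ (Polynomial.X ^ 2 - Polynomial.X + 2) ^ 2) →
    -- (3a): good ordinary reduction at `3`
    (∀ v : HeightOneSpectrum (𝓞 ℚ), ((3 : ℕ) : 𝓞 ℚ) ∈ v.asIdeal →
      A.HasGoodOrdinaryReductionAt v) →
    -- (3b): the characteristic polynomial of Frobenius at `3` has no repeated roots
    (∀ (ℓ : ℕ) [Fact ℓ.Prime], ℓ ≠ 3 →
      ∀ (b : Module.Basis (Fin 4) ℚ_[ℓ] (A.rationalTateModule ℓ))
        (r : FramedGaloisRep ℚ (PadicAlgCl ℓ) 4),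
        (∀ g : Field.absoluteGaloisGroup ℚ,
          (r g).val =
            ((LinearMap.toMatrix b b (A.rationalTateRep ℓ g⁻¹)).map
              (algebraMap ℚ_[ℓ] (PadicAlgCl ℓ))).transpose) →
        ∀ v : HeightOneSpectrum (𝓞 ℚ), ((3 : ℕ) : 𝓞 ℚ) ∈ v.asIdeal →
          r.IsUnramifiedAt v ∧
            ∀ Q : Polynomial (PadicAlgCl ℓ), r.HasFrobCharpolyAt v Q → Q.Separable) →
    -- conclusion: `A` is modular (`GL₄` almost-everywhere form)
    ∀ (p : ℕ) [Fact p.Prime] (b : Module.Basis (Fin 4) ℚ_[p] (A.rationalTateModule p))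
      (r : FramedGaloisRep ℚ (PadicAlgCl p) 4),
      (∀ g : Field.absoluteGaloisGroup ℚ,
        (r g).val =
          ((LinearMap.toMatrix b b (A.rationalTateRep p g⁻¹)).map
            (algebraMap ℚ_[p] (PadicAlgCl p))).transpose) →
      ∀ (hcpt : isCompact_glFiniteIntegralLevel 4 ℚ) (ι : PadicAlgCl p ≃+* ℂ),
        ∃ π : CuspidalAutomorphicRepData 4 ℚ hcpt, π.1.IsLAlgebraic ∧
          ∀ᶠ v : HeightOneSpectrum (𝓞 ℚ) in Filter.cofinite, ∃ a : Multiset ℂ,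
            π.1.HasSatakeParamAt v a ∧ r.IsUnramifiedAt v ∧
              r.HasFrobCharpolyAt v (arithFrobPolyOfSatake ι v.residueCard 1 a)

end Literature.NumberTheory.DiophantineGeometry
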